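import Mathlib

/-!
# Lift-up nilpotency: Duhamel truncation and the Sylvester (Roth) intertwiner

Solo-blind programme, paper §24.96 (4b)–(4c).  In the ideal streak/roll chain the generator is
`h(t) • H₁ + hₓ(t) • N` with `H₁` block-diagonal (streaks ⊕ rolls) and `N` the lift-up coupling
(rolls → streaks).  Hence `N * H₁ ^ k * N = 0` for every `k`, every product containing two `N`'s
vanishes, and the binomial/Duhamel expansion of `(H₁ + N) ^ n` TRUNCATES after the terms with one `N`
(first theorem).  The second group of lemmas is the block-matrix form of Roth's removal rule: the
shear `[[1, K], [0, 1]]` conjugates the block-triangular operator `[[A, F], [0, D]]` to the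
block-diagonal `[[A, 0], [0, D]]` exactly when `K` solves the Sylvester equation `A K - K D = F`
(the intertwiner `K_X = X • K₁` of §24.96 (4c)).  Pure algebra; no analysis.
-/

namespace Summit.AnomalousDissipation.AnomalousDissipation.Theorems

open Finset Matrix

/-- **Duhamel truncation under lift-up nilpotency.**  In any semiring, if `N * H ^ k * N = 0` for all
`k` (two lift-ups with any number of block-diagonal steps in between vanish), then
`(H + N) ^ n = H ^ n + ∑_{j<n} H ^ j * N * H ^ (n-1-j)`: only the words with at most one `N` survive.
This is the discrete form of `e^{τ(𝒜₀+XN)} = e^{τ𝒜₀} + X ∫₀^τ e^{(τ-σ)𝒜₀} N e^{σ𝒜₀} dσ` (§24.96 (4b)). -/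
theorem add_pow_eq_of_sandwich_zero {R : Type*} [Semiring R] (H N : R)
    (hN : ∀ k : ℕ, N * H ^ k * N = 0) (n : ℕ) :
    (H + N) ^ n = H ^ n + ∑ j ∈ range n, H ^ j * N * H ^ (n - 1 - j) := by
  induction n with
  | zero => simp
  | succ n ih =>
    rw [pow_succ, ih, add_mul, mul_add, mul_add, sum_mul, sum_mul]
    have hkill : ∑ j ∈ range n, H ^ j * N * H ^ (n - 1 - j) * N = 0 := by
      apply sum_eq_zero
      intro j _
      rw [mul_assoc (H ^ j * N), mul_assoc (H ^ j), ← mul_assoc N, hN, mul_zero]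
    rw [hkill, add_zero, sum_range_succ, ← pow_succ]
    have hshift : ∑ j ∈ range n, H ^ j * N * H ^ (n - 1 - j) * H
        = ∑ j ∈ range n, H ^ j * N * H ^ (n + 1 - 1 - j) := by
      apply sum_congr rfl
      intro j hj
      rw [mem_range] at hj
      rw [mul_assoc, ← pow_succ, show n - 1 - j + 1 = n + 1 - 1 - j by omega]
    have hlast : H ^ n * N * H ^ (n + 1 - 1 - n) = H ^ n * N := by
      rw [show n + 1 - 1 - n = 0 by omega, pow_zero, mul_one]
    rw [hshift, hlast]
    abel

/-- The hypothesis of `add_pow_eq_of_sandwich_zero` in its natural block form: if `H` preserves a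
splitting (it commutes with an idempotent `p`) and `N` maps the range of `1 - p` into the range of `p`
and kills the range of `p` (`N = p * N * (1 - p)`), then `N * H ^ k * N = 0` for every `k`.
(Streaks = range of `p`, rolls = range of `1 - p`; §24.96 (4b).) -/
theorem sandwich_zero_of_splitting {R : Type*} [Ring R] (H N p : R) (hp : p * p = p)
    (hH : H * p = p * H) (hNp : N = p * N * (1 - p)) (k : ℕ) : N * H ^ k * N = 0 := by
  have hHk : ∀ j : ℕ, H ^ j * p = p * H ^ j := by
    intro j
    induction j with
    | zero => simp
    | succ j ihj => rw [pow_succ, mul_assoc, hH, ← mul_assoc, ihj, mul_assoc]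
  have hkey : (1 - p) * H ^ k * p = 0 := by
    rw [mul_assoc, hHk, ← mul_assoc, sub_mul, one_mul, hp, sub_self, zero_mul]
  calc N * H ^ k * N = (p * N * (1 - p)) * H ^ k * (p * N * (1 - p)) := by rw [← hNp]
    _ = p * N * ((1 - p) * H ^ k * p) * N * (1 - p) := by
        simp only [mul_assoc]
    _ = 0 := by rw [hkey]; simp

/-- **Roth's removal rule / Sylvester intertwiner, block form.**  If `K` solves the Sylvester
equation `A * K - K * D = F`, then the shear `[[1, K], [0, 1]]` intertwines the block-triangular
matrix `[[A, F], [0, D]]` with the block-diagonal `[[A, 0], [0, D]]` (§24.96 (4c): `T_K 𝒜_X = diag(−iU, −iUB) T_K`). -/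
theorem fromBlocks_shear_mul_triangular {R : Type*} [CommRing R] {m n : Type*} [Fintype m] [Fintype n]
    [DecidableEq m] [DecidableEq n] (A : Matrix m m R) (D : Matrix n n R) (F K : Matrix m n R)
    (hK : A * K - K * D = F) :
    fromBlocks 1 K 0 1 * fromBlocks A F 0 D = fromBlocks A 0 0 D * fromBlocks 1 K 0 1 := by
  have hK' : F + K * D = A * K := by rw [← hK]; abel
  simp [fromBlocks_multiply, hK']

/-- The shear is invertible with inverse the opposite shear, so the intertwining above is a genuine
similarity: `[[1, K], [0, 1]] * [[1, -K], [0, 1]] = 1`. -/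
theorem fromBlocks_shear_mul_neg_shear {R : Type*} [CommRing R] {m n : Type*} [Fintype m] [Fintype n]
    [DecidableEq m] [DecidableEq n] (K : Matrix m n R) :
    fromBlocks (1 : Matrix m m R) K 0 (1 : Matrix n n R) * fromBlocks 1 (-K) 0 1 = 1 := by
  simp [fromBlocks_multiply]

/-- Consequently the block-triangular matrix is similar to the block-diagonal one:
`[[A, F], [0, D]] = [[1, -K], [0, 1]] * [[A, 0], [0, D]] * [[1, K], [0, 1]]` whenever
`A * K - K * D = F` — so its powers (and any power series) are the conjugated powers of `diag(A, D)`,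
which is the uniform-in-time bound behind LEMMA C's inviscid half (§24.96 (4c)). -/
theorem fromBlocks_triangular_eq_conj {R : Type*} [CommRing R] {m n : Type*} [Fintype m] [Fintype n]
    [DecidableEq m] [DecidableEq n] (A : Matrix m m R) (D : Matrix n n R) (F K : Matrix m n R)
    (hK : A * K - K * D = F) :
    fromBlocks A F 0 D = fromBlocks 1 (-K) 0 1 * (fromBlocks A 0 0 D * fromBlocks 1 K 0 1) := by
  rw [← fromBlocks_shear_mul_triangular A D F K hK, ← Matrix.mul_assoc]
  have hinv : fromBlocks (1 : Matrix m m R) (-K) 0 (1 : Matrix n n R) * fromBlocks 1 K 0 1 = 1 := by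
    simp [fromBlocks_multiply]
  rw [hinv, Matrix.one_mul]

end Summit.AnomalousDissipation.AnomalousDissipation.Theorems
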